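import Summits.QuantumFields.BalabanUV.Beta.EriceRemainderEnclosureHistoryAutonomyComparisonAgeCompositionTwoClusterLevels
import Summits.QuantumFields.BalabanUV.Beta.EriceRemainderEnclosureHistoryAutonomyComparisonAgeCompositionOldTripleCapC22
import Summits.QuantumFields.BalabanUV.Beta.EriceRemainderEnclosureHistoryAutonomyComparisonAgeCompositionOldTripleCapC23
import Summits.QuantumFields.BalabanUV.Beta.EriceRemainderEnclosureHistoryAutonomyComparisonAgeCompositionOldTripleCapC32
import Summits.QuantumFields.BalabanUV.Beta.EriceRemainderEnclosureHistoryAutonomyComparisonAgeCompositionOldTripleCapC24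
import Summits.QuantumFields.BalabanUV.Beta.EriceRemainderEnclosureHistoryAutonomyComparisonAgeCompositionOldTripleCapC42
import Summits.QuantumFields.BalabanUV.Beta.EriceRemainderEnclosureHistoryAutonomyComparisonAgeCompositionOldTripleCapC33
import Summits.QuantumFields.BalabanUV.Beta.EriceRemainderEnclosureHistoryAutonomyComparisonAgeCompositionOldTripleCapC34
import Summits.QuantumFields.BalabanUV.Beta.EriceRemainderEnclosureHistoryAutonomyComparisonAgeCompositionOldTripleCapC43
import Summits.QuantumFields.BalabanUV.Beta.EriceRemainderEnclosureHistoryAutonomyComparisonAgeCompositionOldTripleCapC44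
import Summits.QuantumFields.BalabanUV.Beta.EriceRemainderEnclosureHistoryAutonomyComparisonAgeCompositionOldTripleCapC28
import Summits.QuantumFields.BalabanUV.Beta.EriceRemainderEnclosureHistoryAutonomyComparisonAgeCompositionOldTripleCapC82
import Summits.QuantumFields.BalabanUV.Beta.EriceRemainderEnclosureHistoryAutonomyComparisonAgeCompositionOldTripleCapC38
import Summits.QuantumFields.BalabanUV.Beta.EriceRemainderEnclosureHistoryAutonomyComparisonAgeCompositionOldTripleCapC83
import Summits.QuantumFields.BalabanUV.Beta.EriceRemainderEnclosureHistoryAutonomyComparisonAgeCompositionOldTripleCapC48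
import Summits.QuantumFields.BalabanUV.Beta.EriceRemainderEnclosureHistoryAutonomyComparisonAgeCompositionOldTripleCapC84
import Summits.QuantumFields.BalabanUV.Beta.EriceRemainderEnclosureHistoryAutonomyComparisonAgeCompositionOldTripleCapC88
import Summits.QuantumFields.BalabanUV.Beta.EriceRemainderEnclosureHistoryAutonomyComparisonAgeCompositionOldTripleCapC2G
import Summits.QuantumFields.BalabanUV.Beta.EriceRemainderEnclosureHistoryAutonomyComparisonAgeCompositionOldTripleCapCG2
import Summits.QuantumFields.BalabanUV.Beta.EriceRemainderEnclosureHistoryAutonomyComparisonAgeCompositionOldTripleCapC3G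
import Summits.QuantumFields.BalabanUV.Beta.EriceRemainderEnclosureHistoryAutonomyComparisonAgeCompositionOldTripleCapCG3
import Summits.QuantumFields.BalabanUV.Beta.EriceRemainderEnclosureHistoryAutonomyComparisonAgeCompositionOldTripleCapC4G
import Summits.QuantumFields.BalabanUV.Beta.EriceRemainderEnclosureHistoryAutonomyComparisonAgeCompositionOldTripleCapCG4
import Summits.QuantumFields.BalabanUV.Beta.EriceRemainderEnclosureHistoryAutonomyComparisonAgeCompositionOldTripleCapC8G
import Summits.QuantumFields.BalabanUV.Beta.EriceRemainderEnclosureHistoryAutonomyComparisonAgeCompositionOldTripleCapCG8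

/-!
# EriceRemainderEnclosureHistoryAutonomyComparisonAgeCompositionFourAgesAnyYoungOldTriple — (E104d) route (N), first order: ANY YOUNG AGE BELOW ONE OLD TRIPLE — the four ages `{a₀, k₃, k₄, k₅}`
# with `a₀ ≥ 1` ARBITRARY (cap `0.7072`, (E94b) `load_le_of_sq`) and the old triple capped by the cell tables (E103e–zb), through the two-cluster engine
# (E99g): **`flow_nonneg_young_age_old_triple_of_cap`** (parametric in the triple cap), and the unions **`flow_nonneg_young_age_old_triple_top4`**
# (`k₃ < k₄ ≤ 4k₃`, `k₄ < k₅ ≤ 4k₄`, `33a₀ ≤ k₃`, `k₃ ≥ 56`), **`…_top8`** (`113a₀ ≤ k₃`), **`…_top8x16`** (`188a₀`), **`…_top16x8`** (`238a₀`) — per cell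
# `ρ₀ = ⌈0.7072(4s(1+κ)+κ)∕((1−s(1+κ))·0.2928)⌉`, `κ = 1∕1000`: 30 ∕ 30 ∕ 30 ∕ 30 ∕ 31 ∕ 31 ∕ 33 ∕ 33 ∕ 33 (both ratios ≤ 4), 42–113 (a ratio in (4,8]), 56–238
# (a ratio in (8,16]).  The companion of (E104a–c) (young pair `{1,k₂}`, `ρ₀` 61–493).

Cell `pub-balaban`, β-function sub-cell, BINDER row D4 «RemainderConst leaves for Bałaban's split» (`HOME/BINDER-OWNERS.md`; owner lineage `b2b-balaban-beta-an4`;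
this file by co-owner #2 lineage `b2b-balaban-beta-d4-p2`, generation 89), β-FLOW TEAM duty (1), FREEZE (0) honoured (def-free; nothing restated).

HONEST FRAMING (page 1, verbatim and binding).  *"Discharging BetaPertH makes Bałaban's UV stability UNCONDITIONAL — a real constructive-QFT result; it is
NOT the continuum limit and NOT the Clay problem."*  THIS FILE DISCHARGES NOTHING OF THE KIND.  Elementary real algebra ∕ real analysis about ABSTRACT
functionals on a box ]0,γ]^ℕ with displayed floors, profiles and signs, and the FIRST-ORDER renewal objects of route (N) built from them — hypotheses of a
census, not facts; the form, signs, ages and moments of Bałaban's (1.22) limit functional are NOT PRINTED ([I] p. 298; GAPS G-t4-U2-1∕-2) and NOT asserted.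
Row D4 class UNCHANGED (critical-path width 0; instance 0∕1; D4 DISCHARGE NO DATE).  HONEST DEPENDENCY: continuum YM on T⁴ ⇐ BetaPertH ∧ nine spine
estimates (0/9 proved); BetaPertH ⇐ (D1) ∧ (D4) ∧ CAP+tail; G-an2-4 gates asym, D1 and NE2/3/4.

THE POINT (README `HOME/b2b-balaban-beta-d4-p2/g89/README.md` §4).  Uses (E99g) `flow_nonneg_two_cluster_levels_of_caps`, (E94b) `load_le_of_sq`, (E103e–zb)
`old_triple_load_le_cXY` BY NAME.  NOT CLAIMED: `k₃ < ρ₀a₀`; the cell `(8,16]²`; anything printed — NOT B12 Thm 2, NOT BetaPertH, NOT continuum, NOT Clay.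

WHAT IS PROVED ([folklore]; 0 `def`, 0 sorry).  §1 **`flow_nonneg_young_age_old_triple_of_cap`**.  §2 **`flow_nonneg_young_age_old_triple_top4 ∕ _top8 ∕
_top8x16 ∕ _top16x8`**.
-/
noncomputable section
open Finset

namespace Summit.QuantumFields.BalabanUV.Beta.EriceRemainderEnclosureHistoryAutonomyComparisonAgeCompositionFourAgesAnyYoungOldTriple

open Literature.MathematicalPhysics.QuantumFieldTheory.Balaban1983to89
open Literature.MathematicalPhysics.QuantumFieldTheory.Balaban1983to89.T4BetaStationary
open Literature.MathematicalPhysics.QuantumFieldTheory.Balaban1983to89.T4BetaFlowWellPosed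
open Summit.QuantumFields.BalabanUV.Beta.EriceRemainderEnclosureHistoryAutonomyComparisonAgeCompositionYoungPairMoment (load_le_of_sq)
open Summit.QuantumFields.BalabanUV.Beta.EriceRemainderEnclosureHistoryAutonomyComparisonAgeCompositionTwoClusterLevels (flow_nonneg_two_cluster_levels_of_caps)
open Summit.QuantumFields.BalabanUV.Beta.EriceRemainderEnclosureHistoryAutonomyComparisonAgeCompositionOldTripleCapC22 (old_triple_load_le_c22)
open Summit.QuantumFields.BalabanUV.Beta.EriceRemainderEnclosureHistoryAutonomyComparisonAgeCompositionOldTripleCapC23 (old_triple_load_le_c23)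
open Summit.QuantumFields.BalabanUV.Beta.EriceRemainderEnclosureHistoryAutonomyComparisonAgeCompositionOldTripleCapC32 (old_triple_load_le_c32)
open Summit.QuantumFields.BalabanUV.Beta.EriceRemainderEnclosureHistoryAutonomyComparisonAgeCompositionOldTripleCapC24 (old_triple_load_le_c24)
open Summit.QuantumFields.BalabanUV.Beta.EriceRemainderEnclosureHistoryAutonomyComparisonAgeCompositionOldTripleCapC42 (old_triple_load_le_c42)
open Summit.QuantumFields.BalabanUV.Beta.EriceRemainderEnclosureHistoryAutonomyComparisonAgeCompositionOldTripleCapC33 (old_triple_load_le_c33)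
open Summit.QuantumFields.BalabanUV.Beta.EriceRemainderEnclosureHistoryAutonomyComparisonAgeCompositionOldTripleCapC34 (old_triple_load_le_c34)
open Summit.QuantumFields.BalabanUV.Beta.EriceRemainderEnclosureHistoryAutonomyComparisonAgeCompositionOldTripleCapC43 (old_triple_load_le_c43)
open Summit.QuantumFields.BalabanUV.Beta.EriceRemainderEnclosureHistoryAutonomyComparisonAgeCompositionOldTripleCapC44 (old_triple_load_le_c44)
open Summit.QuantumFields.BalabanUV.Beta.EriceRemainderEnclosureHistoryAutonomyComparisonAgeCompositionOldTripleCapC28 (old_triple_load_le_c28)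
open Summit.QuantumFields.BalabanUV.Beta.EriceRemainderEnclosureHistoryAutonomyComparisonAgeCompositionOldTripleCapC82 (old_triple_load_le_c82)
open Summit.QuantumFields.BalabanUV.Beta.EriceRemainderEnclosureHistoryAutonomyComparisonAgeCompositionOldTripleCapC38 (old_triple_load_le_c38)
open Summit.QuantumFields.BalabanUV.Beta.EriceRemainderEnclosureHistoryAutonomyComparisonAgeCompositionOldTripleCapC83 (old_triple_load_le_c83)
open Summit.QuantumFields.BalabanUV.Beta.EriceRemainderEnclosureHistoryAutonomyComparisonAgeCompositionOldTripleCapC48 (old_triple_load_le_c48)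
open Summit.QuantumFields.BalabanUV.Beta.EriceRemainderEnclosureHistoryAutonomyComparisonAgeCompositionOldTripleCapC84 (old_triple_load_le_c84)
open Summit.QuantumFields.BalabanUV.Beta.EriceRemainderEnclosureHistoryAutonomyComparisonAgeCompositionOldTripleCapC88 (old_triple_load_le_c88)
open Summit.QuantumFields.BalabanUV.Beta.EriceRemainderEnclosureHistoryAutonomyComparisonAgeCompositionOldTripleCapC2G (old_triple_load_le_c2g)
open Summit.QuantumFields.BalabanUV.Beta.EriceRemainderEnclosureHistoryAutonomyComparisonAgeCompositionOldTripleCapCG2 (old_triple_load_le_cg2)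
open Summit.QuantumFields.BalabanUV.Beta.EriceRemainderEnclosureHistoryAutonomyComparisonAgeCompositionOldTripleCapC3G (old_triple_load_le_c3g)
open Summit.QuantumFields.BalabanUV.Beta.EriceRemainderEnclosureHistoryAutonomyComparisonAgeCompositionOldTripleCapCG3 (old_triple_load_le_cg3)
open Summit.QuantumFields.BalabanUV.Beta.EriceRemainderEnclosureHistoryAutonomyComparisonAgeCompositionOldTripleCapC4G (old_triple_load_le_c4g)
open Summit.QuantumFields.BalabanUV.Beta.EriceRemainderEnclosureHistoryAutonomyComparisonAgeCompositionOldTripleCapCG4 (old_triple_load_le_cg4)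
open Summit.QuantumFields.BalabanUV.Beta.EriceRemainderEnclosureHistoryAutonomyComparisonAgeCompositionOldTripleCapC8G (old_triple_load_le_c8g)
open Summit.QuantumFields.BalabanUV.Beta.EriceRemainderEnclosureHistoryAutonomyComparisonAgeCompositionOldTripleCapCG8 (old_triple_load_le_cg8)

variable {B : (ℕ → ℝ) → ℝ} {γ b gIR : ℝ} {L : ℕ → ℝ} {K : ℕ} {h g : ℕ → ℝ}

/-! ## §1 Any young age below one capped old triple (parametric) -/

/-- **ANY YOUNG AGE BELOW ONE CAPPED OLD TRIPLE (parametric).**  Ages `{a₀, k₃, k₄, k₅}`, `1 ≤ a₀ < k₃ < k₄ < k₅ < K`, the profile vanishing elsewhere; a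
TRIPLE CAP `x_{k₃}(q) + x_{k₄}(q) + x_{k₅}(q) ≤ s` at every pin (hypothesis); closure of (E99g) with `s₀ = 0.7072`: `κ > 0`, `0 ≤ s`, `s(1+κ) < 1`, `ρ₀ ≥ 1`,
`0.7072·(ρ₀(1 − s(1+κ)) + 4s(1+κ) + κ) ≤ ρ₀(1 − s(1+κ))`, gap `ρ₀·a₀ ≤ k₃`.  THEN `0 ≤ ε ≤ e` at every pin ((E99g) with `S₀ = {a₀}` ((E94b) `load_le_of_sq`),
`S₁ = {k₃,k₄,k₅}`). [folklore] -/
theorem flow_nonneg_young_age_old_triple_of_cap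
    (hmono : ∀ u v : ℕ → ℝ, SeqBox γ u → SeqBox γ v → (∀ j, u j ≤ v j) → B u ≤ B v)
    (hL : ∀ k, 0 ≤ L k) (hb : 0 < b) (hlo : ∀ u, SeqBox γ u → b ≤ B u) (hdom : ∀ u, SeqBox γ u → ∑ k ∈ range K, L k * u k ≤ B u)
    (hh : SeqBox γ h) (hf : MemFlow B gIR h) (hg : ∀ t, 0 < g t ∧ g t ≤ 1)
    (hgF : ∀ t, 1 ≤ g t * (1 + ∑ k ∈ range K, L k * h (t + k) ^ 3 / 2))
    {a₀ k₃ k₄ k₅ : ℕ} (ha0 : 1 ≤ a₀) (ha3 : a₀ < k₃) (hk34 : k₃ < k₄) (hk45 : k₄ < k₅) (hk5K : k₅ < K)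
    {κ s : ℝ} {ρ₀ : ℕ} (hκ : 0 < κ) (hs : 0 ≤ s) (hsC : s * (1 + κ) < 1) (hρ₀ : 1 ≤ ρ₀)
    (hyoung : (7072 / 10000 : ℝ) * ((ρ₀ : ℝ) * (1 - s * (1 + κ)) + (4 * s * (1 + κ) + κ)) ≤ (ρ₀ : ℝ) * (1 - s * (1 + κ)))
    (hgap : ρ₀ * a₀ ≤ k₃)
    (htri : ∀ q : ℕ, (k₃ : ℝ) * (L k₃ * h (q + k₃) ^ 3 / 2) + (k₄ : ℝ) * (L k₄ * h (q + k₄) ^ 3 / 2) + (k₅ : ℝ) * (L k₅ * h (q + k₅) ^ 3 / 2) ≤ s)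
    (hLa : ∀ l, l < K → l ≠ a₀ → l ≠ k₃ → l ≠ k₄ → l ≠ k₅ → L l = 0)
    {N : ℕ} {KL : ℕ → ℕ → ℕ → ℝ}
    (hKL : ∀ k n l, KL k n l = if 0 < k ∧ k < K ∧ l < k then L k * h (n + k) ^ 3 / 2 * ∏ t ∈ Ico (n + 1 + l) (n + k + 1), g t else 0)
    {KA : ℕ → ℕ → ℕ → ℝ} {RA : ℕ → (ℕ → ℝ) → ℕ → ℝ}
    (hRA : ∀ i v m, RA i v m = ∑ l ∈ range K, KA i m l * v (m + 1 + l))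
    (hKA : ∀ i m l, KA i m l = KL i m l + KA (i + 1) m l) (hKAtop : ∀ m l, KA K m l = 0)
    {e ε : ℕ → ℝ} (he0 : ∀ m, 0 ≤ e m) (hea : ∀ m, e (m + 1) ≤ e m)
    (hεt : ∀ m, N < m → ε m = 0) (hεrec : ∀ m, ε m = e m - RA 1 ε m) : ∀ m, 0 ≤ ε m ∧ ε m ≤ e m := by
  refine flow_nonneg_two_cluster_levels_of_caps hmono hL hb hlo hdom hh hf hg hgF (by omega) hκ hs hsC hρ₀ hyoung
    (S₀ := {a₀}) (S₁ := {k₃, k₄, k₅}) (hi₀ := a₀) (lo₁ := k₃) (hi₁ := k₅)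
    (fun k hk => ?_) (fun k hk => ?_) (fun k hk => ?_) (fun k hk => ?_) (fun k hk => ?_) (by omega) hgap (fun x hx y hy => ?_)
    (fun l hl h0 h1 => ?_) (fun q => ?_) (fun q => ?_) hKL hRA hKA hKAtop he0 hea hεt hεrec
  · rw [mem_singleton] at hk; subst hk; exact ⟨ha0, by omega⟩
  · rw [mem_singleton] at hk; omega
  · simp only [mem_insert, mem_singleton] at hk; rcases hk with rfl | rfl | rfl <;> omega
  · simp only [mem_insert, mem_singleton] at hk; rcases hk with rfl | rfl | rfl <;> omega
  · simp only [mem_insert, mem_singleton] at hk; rcases hk with rfl | rfl | rfl <;> omega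
  · rw [mem_singleton] at hx
    simp only [mem_insert, mem_singleton] at hy
    rcases hy with rfl | rfl | rfl <;> omega
  · refine hLa l hl (fun he => h0 ?_) (fun he => h1 ?_) (fun he => h1 ?_) (fun he => h1 ?_)
    · rw [he]; exact mem_singleton_self _
    · rw [he]; exact mem_insert_self _ _
    · rw [he]; exact mem_insert_of_mem (mem_insert_self _ _)
    · rw [he]; exact mem_insert_of_mem (mem_insert_of_mem (mem_singleton_self _))
  · rw [sum_singleton]
    have ha0r : (1 : ℝ) ≤ a₀ := by exact_mod_cast ha0
    exact load_le_of_sq hmono hL hb hlo hdom hh hf ha0 (by omega) (so := 7072 / 10000) (by norm_num) (by nlinarith) q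
  · rw [sum_insert (by simp; omega), sum_pair (show k₄ ≠ k₅ by omega)]
    have := htri q
    linarith

/-! ## §2 The unions over the cells -/

/-- **ANY YOUNG AGE + AN OLD TRIPLE WITH BOTH TOP RATIOS AT MOST 4.**  `1 ≤ a₀`, `33a₀ ≤ k₃`, `56 ≤ k₃`, `k₃ < k₄ ≤ 4k₃`, `k₄ < k₅ ≤ 4k₄`, `k₅ < K`, profile on
`{a₀, k₃, k₄, k₅}`: `0 ≤ ε ≤ e` at every pin, every horizon, every damping of the self-consistent class (nine cells, `ρ₀ ≤ 33`). [folklore] -/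
theorem flow_nonneg_young_age_old_triple_top4
    (hmono : ∀ u v : ℕ → ℝ, SeqBox γ u → SeqBox γ v → (∀ j, u j ≤ v j) → B u ≤ B v)
    (hL : ∀ k, 0 ≤ L k) (hb : 0 < b) (hlo : ∀ u, SeqBox γ u → b ≤ B u) (hdom : ∀ u, SeqBox γ u → ∑ k ∈ range K, L k * u k ≤ B u)
    (hh : SeqBox γ h) (hf : MemFlow B gIR h) (hg : ∀ t, 0 < g t ∧ g t ≤ 1)
    (hgF : ∀ t, 1 ≤ g t * (1 + ∑ k ∈ range K, L k * h (t + k) ^ 3 / 2))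
    {a₀ k₃ k₄ k₅ : ℕ} (ha0 : 1 ≤ a₀) (hk3 : 33 * a₀ ≤ k₃) (hk356 : 56 ≤ k₃)
    (h34l : k₃ < k₄) (h34h : k₄ ≤ 4 * k₃) (h45l : k₄ < k₅) (h45h : k₅ ≤ 4 * k₄) (hk5K : k₅ < K)
    (hLa : ∀ l, l < K → l ≠ a₀ → l ≠ k₃ → l ≠ k₄ → l ≠ k₅ → L l = 0)
    {N : ℕ} {KL : ℕ → ℕ → ℕ → ℝ}
    (hKL : ∀ k n l, KL k n l = if 0 < k ∧ k < K ∧ l < k then L k * h (n + k) ^ 3 / 2 * ∏ t ∈ Ico (n + 1 + l) (n + k + 1), g t else 0)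
    {KA : ℕ → ℕ → ℕ → ℝ} {RA : ℕ → (ℕ → ℝ) → ℕ → ℝ}
    (hRA : ∀ i v m, RA i v m = ∑ l ∈ range K, KA i m l * v (m + 1 + l))
    (hKA : ∀ i m l, KA i m l = KL i m l + KA (i + 1) m l) (hKAtop : ∀ m l, KA K m l = 0)
    {e ε : ℕ → ℝ} (he0 : ∀ m, 0 ≤ e m) (hea : ∀ m, e (m + 1) ≤ e m)
    (hεt : ∀ m, N < m → ε m = 0) (hεrec : ∀ m, ε m = e m - RA 1 ε m) : ∀ m, 0 ≤ ε m ∧ ε m ≤ e m := by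
  rcases le_or_gt k₄ (2 * k₃) with ha | ha
  · rcases le_or_gt k₅ (2 * k₄) with hb' | hb'
    · exact flow_nonneg_young_age_old_triple_of_cap hmono hL hb hlo hdom hh hf hg hgF ha0 (by omega) (by omega) (by omega) hk5K
          (s := 3 / 4) (κ := 1 / 1000) (ρ₀ := 30) (by norm_num) (by norm_num) (by norm_num) (by norm_num) (by norm_num) (by omega)
          (fun q => old_triple_load_le_c22 hmono hL hb hlo hdom hh hf hk356 (by omega) ha (by omega) hb' hk5K q) hLa hKL hRA hKA hKAtop he0 hea hεt hεrec
    rcases le_or_gt k₅ (3 * k₄) with hc | hc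
    · exact flow_nonneg_young_age_old_triple_of_cap hmono hL hb hlo hdom hh hf hg hgF ha0 (by omega) (by omega) (by omega) hk5K
          (s := 3 / 4) (κ := 1 / 1000) (ρ₀ := 30) (by norm_num) (by norm_num) (by norm_num) (by norm_num) (by norm_num) (by omega)
          (fun q => old_triple_load_le_c23 hmono hL hb hlo hdom hh hf hk356 (by omega) ha hb' hc hk5K q) hLa hKL hRA hKA hKAtop he0 hea hεt hεrec
    · exact flow_nonneg_young_age_old_triple_of_cap hmono hL hb hlo hdom hh hf hg hgF ha0 (by omega) (by omega) (by omega) hk5K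
          (s := 3 / 4) (κ := 1 / 1000) (ρ₀ := 30) (by norm_num) (by norm_num) (by norm_num) (by norm_num) (by norm_num) (by omega)
          (fun q => old_triple_load_le_c24 hmono hL hb hlo hdom hh hf hk356 (by omega) ha hc h45h hk5K q) hLa hKL hRA hKA hKAtop he0 hea hεt hεrec
  rcases le_or_gt k₄ (3 * k₃) with ha2 | ha2
  · rcases le_or_gt k₅ (2 * k₄) with hb' | hb'
    · exact flow_nonneg_young_age_old_triple_of_cap hmono hL hb hlo hdom hh hf hg hgF ha0 (by omega) (by omega) (by omega) hk5K
          (s := 3 / 4) (κ := 1 / 1000) (ρ₀ := 30) (by norm_num) (by norm_num) (by norm_num) (by norm_num) (by norm_num) (by omega)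
          (fun q => old_triple_load_le_c32 hmono hL hb hlo hdom hh hf hk356 ha ha2 (by omega) hb' hk5K q) hLa hKL hRA hKA hKAtop he0 hea hεt hεrec
    rcases le_or_gt k₅ (3 * k₄) with hc | hc
    · exact flow_nonneg_young_age_old_triple_of_cap hmono hL hb hlo hdom hh hf hg hgF ha0 (by omega) (by omega) (by omega) hk5K
          (s := 19 / 25) (κ := 1 / 1000) (ρ₀ := 31) (by norm_num) (by norm_num) (by norm_num) (by norm_num) (by norm_num) (by omega)
          (fun q => old_triple_load_le_c33 hmono hL hb hlo hdom hh hf hk356 ha ha2 hb' hc hk5K q) hLa hKL hRA hKA hKAtop he0 hea hεt hεrec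
    · exact flow_nonneg_young_age_old_triple_of_cap hmono hL hb hlo hdom hh hf hg hgF ha0 (by omega) (by omega) (by omega) hk5K
          (s := 77 / 100) (κ := 1 / 1000) (ρ₀ := 33) (by norm_num) (by norm_num) (by norm_num) (by norm_num) (by norm_num) (by omega)
          (fun q => old_triple_load_le_c34 hmono hL hb hlo hdom hh hf hk356 ha ha2 hc h45h hk5K q) hLa hKL hRA hKA hKAtop he0 hea hεt hεrec
  · rcases le_or_gt k₅ (2 * k₄) with hb' | hb'
    · exact flow_nonneg_young_age_old_triple_of_cap hmono hL hb hlo hdom hh hf hg hgF ha0 (by omega) (by omega) (by omega) hk5K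
          (s := 19 / 25) (κ := 1 / 1000) (ρ₀ := 31) (by norm_num) (by norm_num) (by norm_num) (by norm_num) (by norm_num) (by omega)
          (fun q => old_triple_load_le_c42 hmono hL hb hlo hdom hh hf hk356 ha2 h34h (by omega) hb' hk5K q) hLa hKL hRA hKA hKAtop he0 hea hεt hεrec
    rcases le_or_gt k₅ (3 * k₄) with hc | hc
    · exact flow_nonneg_young_age_old_triple_of_cap hmono hL hb hlo hdom hh hf hg hgF ha0 (by omega) (by omega) (by omega) hk5K
          (s := 77 / 100) (κ := 1 / 1000) (ρ₀ := 33) (by norm_num) (by norm_num) (by norm_num) (by norm_num) (by norm_num) (by omega)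
          (fun q => old_triple_load_le_c43 hmono hL hb hlo hdom hh hf hk356 ha2 h34h hb' hc hk5K q) hLa hKL hRA hKA hKAtop he0 hea hεt hεrec
    · exact flow_nonneg_young_age_old_triple_of_cap hmono hL hb hlo hdom hh hf hg hgF ha0 (by omega) (by omega) (by omega) hk5K
          (s := 77 / 100) (κ := 1 / 1000) (ρ₀ := 33) (by norm_num) (by norm_num) (by norm_num) (by norm_num) (by norm_num) (by omega)
          (fun q => old_triple_load_le_c44 hmono hL hb hlo hdom hh hf hk356 ha2 h34h hc h45h hk5K q) hLa hKL hRA hKA hKAtop he0 hea hεt hεrec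

/-- **ANY YOUNG AGE + AN OLD TRIPLE WITH BOTH TOP RATIOS AT MOST 8.**  `1 ≤ a₀`, `113a₀ ≤ k₃` (`≥ 56`), `k₃ < k₄ ≤ 8k₃`, `k₄ < k₅ ≤ 8k₄`, `k₅ < K`: `0 ≤ ε ≤ e` at
every pin (`…_top4` and seven cells, `ρ₀ ≤ 113`). [folklore] -/
theorem flow_nonneg_young_age_old_triple_top8
    (hmono : ∀ u v : ℕ → ℝ, SeqBox γ u → SeqBox γ v → (∀ j, u j ≤ v j) → B u ≤ B v)
    (hL : ∀ k, 0 ≤ L k) (hb : 0 < b) (hlo : ∀ u, SeqBox γ u → b ≤ B u) (hdom : ∀ u, SeqBox γ u → ∑ k ∈ range K, L k * u k ≤ B u)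
    (hh : SeqBox γ h) (hf : MemFlow B gIR h) (hg : ∀ t, 0 < g t ∧ g t ≤ 1)
    (hgF : ∀ t, 1 ≤ g t * (1 + ∑ k ∈ range K, L k * h (t + k) ^ 3 / 2))
    {a₀ k₃ k₄ k₅ : ℕ} (ha0 : 1 ≤ a₀) (hk3 : 113 * a₀ ≤ k₃) (hk356 : 56 ≤ k₃)
    (h34l : k₃ < k₄) (h34h : k₄ ≤ 8 * k₃) (h45l : k₄ < k₅) (h45h : k₅ ≤ 8 * k₄) (hk5K : k₅ < K)
    (hLa : ∀ l, l < K → l ≠ a₀ → l ≠ k₃ → l ≠ k₄ → l ≠ k₅ → L l = 0)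
    {N : ℕ} {KL : ℕ → ℕ → ℕ → ℝ}
    (hKL : ∀ k n l, KL k n l = if 0 < k ∧ k < K ∧ l < k then L k * h (n + k) ^ 3 / 2 * ∏ t ∈ Ico (n + 1 + l) (n + k + 1), g t else 0)
    {KA : ℕ → ℕ → ℕ → ℝ} {RA : ℕ → (ℕ → ℝ) → ℕ → ℝ}
    (hRA : ∀ i v m, RA i v m = ∑ l ∈ range K, KA i m l * v (m + 1 + l))
    (hKA : ∀ i m l, KA i m l = KL i m l + KA (i + 1) m l) (hKAtop : ∀ m l, KA K m l = 0)
    {e ε : ℕ → ℝ} (he0 : ∀ m, 0 ≤ e m) (hea : ∀ m, e (m + 1) ≤ e m)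
    (hεt : ∀ m, N < m → ε m = 0) (hεrec : ∀ m, ε m = e m - RA 1 ε m) : ∀ m, 0 ≤ ε m ∧ ε m ≤ e m := by
  rcases le_or_gt k₄ (4 * k₃) with ha | ha
  · rcases le_or_gt k₅ (4 * k₄) with hb' | hb'
    · exact flow_nonneg_young_age_old_triple_top4 hmono hL hb hlo hdom hh hf hg hgF ha0 (by omega) hk356 h34l ha h45l hb' hk5K hLa hKL hRA hKA hKAtop he0 hea hεt hεrec
    rcases le_or_gt k₄ (2 * k₃) with h2 | h2
    · exact flow_nonneg_young_age_old_triple_of_cap hmono hL hb hlo hdom hh hf hg hgF ha0 (by omega) (by omega) (by omega) hk5K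
          (s := 81 / 100) (κ := 1 / 1000) (ρ₀ := 42) (by norm_num) (by norm_num) (by norm_num) (by norm_num) (by norm_num) (by omega)
          (fun q => old_triple_load_le_c28 hmono hL hb hlo hdom hh hf hk356 (by omega) h2 hb' h45h hk5K q) hLa hKL hRA hKA hKAtop he0 hea hεt hεrec
    rcases le_or_gt k₄ (3 * k₃) with h3 | h3
    · exact flow_nonneg_young_age_old_triple_of_cap hmono hL hb hlo hdom hh hf hg hgF ha0 (by omega) (by omega) (by omega) hk5K
          (s := 41 / 50) (κ := 1 / 1000) (ρ₀ := 45) (by norm_num) (by norm_num) (by norm_num) (by norm_num) (by norm_num) (by omega)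
          (fun q => old_triple_load_le_c38 hmono hL hb hlo hdom hh hf hk356 h2 h3 hb' h45h hk5K q) hLa hKL hRA hKA hKAtop he0 hea hεt hεrec
    · exact flow_nonneg_young_age_old_triple_of_cap hmono hL hb hlo hdom hh hf hg hgF ha0 (by omega) (by omega) (by omega) hk5K
          (s := 21 / 25) (κ := 1 / 1000) (ρ₀ := 52) (by norm_num) (by norm_num) (by norm_num) (by norm_num) (by norm_num) (by omega)
          (fun q => old_triple_load_le_c48 hmono hL hb hlo hdom hh hf hk356 h3 ha hb' h45h hk5K q) hLa hKL hRA hKA hKAtop he0 hea hεt hεrec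
  rcases le_or_gt k₅ (2 * k₄) with h2 | h2
  · exact flow_nonneg_young_age_old_triple_of_cap hmono hL hb hlo hdom hh hf hg hgF ha0 (by omega) (by omega) (by omega) hk5K
          (s := 41 / 50) (κ := 1 / 1000) (ρ₀ := 45) (by norm_num) (by norm_num) (by norm_num) (by norm_num) (by norm_num) (by omega)
          (fun q => old_triple_load_le_c82 hmono hL hb hlo hdom hh hf hk356 ha h34h (by omega) h2 hk5K q) hLa hKL hRA hKA hKAtop he0 hea hεt hεrec
  rcases le_or_gt k₅ (3 * k₄) with h3 | h3
  · exact flow_nonneg_young_age_old_triple_of_cap hmono hL hb hlo hdom hh hf hg hgF ha0 (by omega) (by omega) (by omega) hk5K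
          (s := 21 / 25) (κ := 1 / 1000) (ρ₀ := 52) (by norm_num) (by norm_num) (by norm_num) (by norm_num) (by norm_num) (by omega)
          (fun q => old_triple_load_le_c83 hmono hL hb hlo hdom hh hf hk356 ha h34h h2 h3 hk5K q) hLa hKL hRA hKA hKAtop he0 hea hεt hεrec
  rcases le_or_gt k₅ (4 * k₄) with h4 | h4
  · exact flow_nonneg_young_age_old_triple_of_cap hmono hL hb hlo hdom hh hf hg hgF ha0 (by omega) (by omega) (by omega) hk5K
          (s := 17 / 20) (κ := 1 / 1000) (ρ₀ := 56) (by norm_num) (by norm_num) (by norm_num) (by norm_num) (by norm_num) (by omega)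
          (fun q => old_triple_load_le_c84 hmono hL hb hlo hdom hh hf hk356 ha h34h h3 h4 hk5K q) hLa hKL hRA hKA hKAtop he0 hea hεt hεrec
  · exact flow_nonneg_young_age_old_triple_of_cap hmono hL hb hlo hdom hh hf hg hgF ha0 (by omega) (by omega) (by omega) hk5K
          (s := 23 / 25) (κ := 1 / 1000) (ρ₀ := 113) (by norm_num) (by norm_num) (by norm_num) (by norm_num) (by norm_num) (by omega)
          (fun q => old_triple_load_le_c88 hmono hL hb hlo hdom hh hf hk356 ha h34h h4 h45h hk5K q) hLa hKL hRA hKA hKAtop he0 hea hεt hεrec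

/-- **ANY YOUNG AGE + AN OLD TRIPLE, `k₄ ≤ 8k₃`, `k₅ ≤ 16k₄`.**  `1 ≤ a₀`, `188a₀ ≤ k₃` (`≥ 56`), `k₃ < k₄ ≤ 8k₃`, `k₄ < k₅ ≤ 16k₄`, `k₅ < K`: `0 ≤ ε ≤ e` at every
pin (`…_top8` and the cells `c2g, c3g, c4g, c8g`). [folklore] -/
theorem flow_nonneg_young_age_old_triple_top8x16
    (hmono : ∀ u v : ℕ → ℝ, SeqBox γ u → SeqBox γ v → (∀ j, u j ≤ v j) → B u ≤ B v)
    (hL : ∀ k, 0 ≤ L k) (hb : 0 < b) (hlo : ∀ u, SeqBox γ u → b ≤ B u) (hdom : ∀ u, SeqBox γ u → ∑ k ∈ range K, L k * u k ≤ B u)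
    (hh : SeqBox γ h) (hf : MemFlow B gIR h) (hg : ∀ t, 0 < g t ∧ g t ≤ 1)
    (hgF : ∀ t, 1 ≤ g t * (1 + ∑ k ∈ range K, L k * h (t + k) ^ 3 / 2))
    {a₀ k₃ k₄ k₅ : ℕ} (ha0 : 1 ≤ a₀) (hk3 : 188 * a₀ ≤ k₃) (hk356 : 56 ≤ k₃)
    (h34l : k₃ < k₄) (h34h : k₄ ≤ 8 * k₃) (h45l : k₄ < k₅) (h45h : k₅ ≤ 16 * k₄) (hk5K : k₅ < K)
    (hLa : ∀ l, l < K → l ≠ a₀ → l ≠ k₃ → l ≠ k₄ → l ≠ k₅ → L l = 0)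
    {N : ℕ} {KL : ℕ → ℕ → ℕ → ℝ}
    (hKL : ∀ k n l, KL k n l = if 0 < k ∧ k < K ∧ l < k then L k * h (n + k) ^ 3 / 2 * ∏ t ∈ Ico (n + 1 + l) (n + k + 1), g t else 0)
    {KA : ℕ → ℕ → ℕ → ℝ} {RA : ℕ → (ℕ → ℝ) → ℕ → ℝ}
    (hRA : ∀ i v m, RA i v m = ∑ l ∈ range K, KA i m l * v (m + 1 + l))
    (hKA : ∀ i m l, KA i m l = KL i m l + KA (i + 1) m l) (hKAtop : ∀ m l, KA K m l = 0)
    {e ε : ℕ → ℝ} (he0 : ∀ m, 0 ≤ e m) (hea : ∀ m, e (m + 1) ≤ e m)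
    (hεt : ∀ m, N < m → ε m = 0) (hεrec : ∀ m, ε m = e m - RA 1 ε m) : ∀ m, 0 ≤ ε m ∧ ε m ≤ e m := by
  rcases le_or_gt k₅ (8 * k₄) with hb' | hb'
  · exact flow_nonneg_young_age_old_triple_top8 hmono hL hb hlo hdom hh hf hg hgF ha0 (by omega) hk356 h34l h34h h45l hb' hk5K hLa hKL hRA hKA hKAtop he0 hea hεt hεrec
  rcases le_or_gt k₄ (2 * k₃) with h2 | h2
  · exact flow_nonneg_young_age_old_triple_of_cap hmono hL hb hlo hdom hh hf hg hgF ha0 (by omega) (by omega) (by omega) hk5K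
          (s := 17 / 20) (κ := 1 / 1000) (ρ₀ := 56) (by norm_num) (by norm_num) (by norm_num) (by norm_num) (by norm_num) (by omega)
          (fun q => old_triple_load_le_c2g hmono hL hb hlo hdom hh hf hk356 (by omega) h2 hb' h45h hk5K q) hLa hKL hRA hKA hKAtop he0 hea hεt hεrec
  rcases le_or_gt k₄ (3 * k₃) with h3 | h3
  · exact flow_nonneg_young_age_old_triple_of_cap hmono hL hb hlo hdom hh hf hg hgF ha0 (by omega) (by omega) (by omega) hk5K
          (s := 43 / 50) (κ := 1 / 1000) (ρ₀ := 60) (by norm_num) (by norm_num) (by norm_num) (by norm_num) (by norm_num) (by omega)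
          (fun q => old_triple_load_le_c3g hmono hL hb hlo hdom hh hf hk356 h2 h3 hb' h45h hk5K q) hLa hKL hRA hKA hKAtop he0 hea hεt hεrec
  rcases le_or_gt k₄ (4 * k₃) with h4 | h4
  · exact flow_nonneg_young_age_old_triple_of_cap hmono hL hb hlo hdom hh hf hg hgF ha0 (by omega) (by omega) (by omega) hk5K
          (s := 22 / 25) (κ := 1 / 1000) (ρ₀ := 72) (by norm_num) (by norm_num) (by norm_num) (by norm_num) (by norm_num) (by omega)
          (fun q => old_triple_load_le_c4g hmono hL hb hlo hdom hh hf hk356 h3 h4 hb' h45h hk5K q) hLa hKL hRA hKA hKAtop he0 hea hεt hεrec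
  · exact flow_nonneg_young_age_old_triple_of_cap hmono hL hb hlo hdom hh hf hg hgF ha0 (by omega) (by omega) (by omega) hk5K
          (s := 19 / 20) (κ := 1 / 1000) (ρ₀ := 188) (by norm_num) (by norm_num) (by norm_num) (by norm_num) (by norm_num) (by omega)
          (fun q => old_triple_load_le_c8g hmono hL hb hlo hdom hh hf hk356 h4 h34h hb' h45h hk5K q) hLa hKL hRA hKA hKAtop he0 hea hεt hεrec

/-- **ANY YOUNG AGE + AN OLD TRIPLE, `k₄ ≤ 16k₃`, `k₅ ≤ 8k₄`.**  `1 ≤ a₀`, `238a₀ ≤ k₃` (`≥ 56`), `k₃ < k₄ ≤ 16k₃`, `k₄ < k₅ ≤ 8k₄`, `k₅ < K`: `0 ≤ ε ≤ e` at every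
pin (`…_top8` and the cells `cg2, cg3, cg4, cg8`). [folklore] -/
theorem flow_nonneg_young_age_old_triple_top16x8
    (hmono : ∀ u v : ℕ → ℝ, SeqBox γ u → SeqBox γ v → (∀ j, u j ≤ v j) → B u ≤ B v)
    (hL : ∀ k, 0 ≤ L k) (hb : 0 < b) (hlo : ∀ u, SeqBox γ u → b ≤ B u) (hdom : ∀ u, SeqBox γ u → ∑ k ∈ range K, L k * u k ≤ B u)
    (hh : SeqBox γ h) (hf : MemFlow B gIR h) (hg : ∀ t, 0 < g t ∧ g t ≤ 1)
    (hgF : ∀ t, 1 ≤ g t * (1 + ∑ k ∈ range K, L k * h (t + k) ^ 3 / 2))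
    {a₀ k₃ k₄ k₅ : ℕ} (ha0 : 1 ≤ a₀) (hk3 : 238 * a₀ ≤ k₃) (hk356 : 56 ≤ k₃)
    (h34l : k₃ < k₄) (h34h : k₄ ≤ 16 * k₃) (h45l : k₄ < k₅) (h45h : k₅ ≤ 8 * k₄) (hk5K : k₅ < K)
    (hLa : ∀ l, l < K → l ≠ a₀ → l ≠ k₃ → l ≠ k₄ → l ≠ k₅ → L l = 0)
    {N : ℕ} {KL : ℕ → ℕ → ℕ → ℝ}
    (hKL : ∀ k n l, KL k n l = if 0 < k ∧ k < K ∧ l < k then L k * h (n + k) ^ 3 / 2 * ∏ t ∈ Ico (n + 1 + l) (n + k + 1), g t else 0)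
    {KA : ℕ → ℕ → ℕ → ℝ} {RA : ℕ → (ℕ → ℝ) → ℕ → ℝ}
    (hRA : ∀ i v m, RA i v m = ∑ l ∈ range K, KA i m l * v (m + 1 + l))
    (hKA : ∀ i m l, KA i m l = KL i m l + KA (i + 1) m l) (hKAtop : ∀ m l, KA K m l = 0)
    {e ε : ℕ → ℝ} (he0 : ∀ m, 0 ≤ e m) (hea : ∀ m, e (m + 1) ≤ e m)
    (hεt : ∀ m, N < m → ε m = 0) (hεrec : ∀ m, ε m = e m - RA 1 ε m) : ∀ m, 0 ≤ ε m ∧ ε m ≤ e m := by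
  rcases le_or_gt k₄ (8 * k₃) with ha | ha
  · exact flow_nonneg_young_age_old_triple_top8 hmono hL hb hlo hdom hh hf hg hgF ha0 (by omega) hk356 h34l ha h45l h45h hk5K hLa hKL hRA hKA hKAtop he0 hea hεt hεrec
  rcases le_or_gt k₅ (2 * k₄) with h2 | h2
  · exact flow_nonneg_young_age_old_triple_of_cap hmono hL hb hlo hdom hh hf hg hgF ha0 (by omega) (by omega) (by omega) hk5K
          (s := 43 / 50) (κ := 1 / 1000) (ρ₀ := 60) (by norm_num) (by norm_num) (by norm_num) (by norm_num) (by norm_num) (by omega)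
          (fun q => old_triple_load_le_cg2 hmono hL hb hlo hdom hh hf hk356 ha h34h (by omega) h2 hk5K q) hLa hKL hRA hKA hKAtop he0 hea hεt hεrec
  rcases le_or_gt k₅ (3 * k₄) with h3 | h3
  · exact flow_nonneg_young_age_old_triple_of_cap hmono hL hb hlo hdom hh hf hg hgF ha0 (by omega) (by omega) (by omega) hk5K
          (s := 22 / 25) (κ := 1 / 1000) (ρ₀ := 72) (by norm_num) (by norm_num) (by norm_num) (by norm_num) (by norm_num) (by omega)
          (fun q => old_triple_load_le_cg3 hmono hL hb hlo hdom hh hf hk356 ha h34h h2 h3 hk5K q) hLa hKL hRA hKA hKAtop he0 hea hεt hεrec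
  rcases le_or_gt k₅ (4 * k₄) with h4 | h4
  · exact flow_nonneg_young_age_old_triple_of_cap hmono hL hb hlo hdom hh hf hg hgF ha0 (by omega) (by omega) (by omega) hk5K
          (s := 89 / 100) (κ := 1 / 1000) (ρ₀ := 79) (by norm_num) (by norm_num) (by norm_num) (by norm_num) (by norm_num) (by omega)
          (fun q => old_triple_load_le_cg4 hmono hL hb hlo hdom hh hf hk356 ha h34h h3 h4 hk5K q) hLa hKL hRA hKA hKAtop he0 hea hεt hεrec
  · exact flow_nonneg_young_age_old_triple_of_cap hmono hL hb hlo hdom hh hf hg hgF ha0 (by omega) (by omega) (by omega) hk5K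
          (s := 24 / 25) (κ := 1 / 1000) (ρ₀ := 238) (by norm_num) (by norm_num) (by norm_num) (by norm_num) (by norm_num) (by omega)
          (fun q => old_triple_load_le_cg8 hmono hL hb hlo hdom hh hf hk356 ha h34h h4 h45h hk5K q) hLa hKL hRA hKA hKAtop he0 hea hεt hεrec

end Summit.QuantumFields.BalabanUV.Beta.EriceRemainderEnclosureHistoryAutonomyComparisonAgeCompositionFourAgesAnyYoungOldTriple
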